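import Summits.AtomisticToContinuum.BoseEinsteinCondensation.Theorems.BECCutLineWeakDisorderWitnessTransferGlue
import Summits.AtomisticToContinuum.BoseEinsteinCondensation.Theorems.BECCutLineWeakDisorderWitnessTransferHeig
import Summits.AtomisticToContinuum.BoseEinsteinCondensation.Theorems.BECCutLineWeakDisorderWitnessTransferEnvelope
import Summits.AtomisticToContinuum.BoseEinsteinCondensation.Theorems.BECCutLineWeakDisorderWitnessTransferFormBound
import Summits.AtomisticToContinuum.BoseEinsteinCondensation.Theorems.BECCutLineWeakDisorderWitnessTransferTrialState
import Summits.AtomisticToContinuum.BoseEinsteinCondensation.Theorems.BECCutLineWeakDisorderWitnessTransferRatioMollify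
import Summits.AtomisticToContinuum.BoseEinsteinCondensation.Theses.BECCutLineWeakDisorder
import Summits.AtomisticToContinuum.BoseEinsteinCondensation.Theorems.BECCutLineWeakDisorderWitnessTransferVanishHardSphere
import Summits.AtomisticToContinuum.BoseEinsteinCondensation.Theorems.BECCutLineWeakDisorderWitnessTransferVanishStrongRepulsion
import Summits.AtomisticToContinuum.BoseEinsteinCondensation.Theorems.BECCutLineWeakDisorderWitnessTransferVanishOfPointwise
import HarnessLib

/-!
# Route BECCutLineWeakDisorder — `WitnessTransfer`, line `Sketch`: the transfer for potentials
without a hard set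

Support file (does not close the item) for the crux stmt-AtomisticToContinuum-14978
(`Summit.AtomisticToContinuum.BoseEinsteinCondensation.Theses.BECCutLineWeakDisorder.WitnessTransfer`
`= (TwoReplicaTransienceBound → LandscapeBound)`). With the parts (B) `stub_heig`, (C)
`stub_envelope`, (E1a) `stub_formBound`, (E1b) `stub_trialState`, (F) `stub_ratio_mollify` and the
glue `glue_landscape_at` all proved, the only input of line `Sketch` that is not available for a
general admissible `v` is (E2), the uniform vanishing of `e^{-TH}1` near the hard-set
configurations `{xᵢ − xⱼ ∈ hardVec v}`. It is VACUOUS when the hard set is empty, which is the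
case for every locally integrable pair potential — in particular for bounded ones and for the
"soft" potentials `∫ v(|x|) dx < ∞` of the tree. This file records the resulting unconditional
transfers at such `v`:

* `landscapeClause_of_twoReplicaClause` — the pointwise transfer at an admissible `v` given (E2)
  at that `v` only;
* `hardVec_eq_empty_of_ballIntegral_lt_top`, `hardVec_eq_empty_of_bounded`,
  `hardVec_eq_empty_of_lintegral_ne_top` — no hard set for locally integrable / bounded / soft `v`;
* `landscapeClause_of_twoReplicaClause_of_hardVec_eq_empty`,
  `witnessTransfer_of_bounded`, `witnessTransfer_of_soft` — **the crux's conclusion for every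
  admissible `v` without a hard set** (engine ⇒ hinge clause at `v`), unconditionally.
## Appendix (appended): hard spheres, strongly repulsive hard sets, pointwise vanishing

(E2) is moreover a THEOREM for hard spheres with an integrable tail (`stub_vanish_hardSphere`),
for strongly repulsive hard sets `v ≥ c d^{-p}`, `p > 2` (`stub_vanish_of_strongRepulsion`), and
follows in general from the pointwise vanishing of `e^{-TH}1` at the hard-set configurations
(`stub_vanish_of_pointwise`); the corresponding unconditional transfers are
`witnessTransfer_of_hardSphere`, `witnessTransfer_of_hardCore_boundedTail` (the textbook class:
`v = ⊤` on `[0,a)`, bounded beyond `a`), `witnessTransfer_of_strongRepulsion`,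
`witnessTransfer_of_pointwiseVanishing`. Together with the bounded/soft cases this covers every
standard pair interaction of the dilute Bose gas; only pathological admissible `v` (thin non-`L¹`
shells with finite `v`, `v = ⊤` on nowhere dense sets of positive measure, borderline `d^{-2}`
walls) remain, pending Brownian local times in the tree.
-/

noncomputable section

open MeasureTheory Filter Set Metric
open scoped ENNReal NNReal Topology

namespace Summit.AtomisticToContinuum.BoseEinsteinCondensation.Theorems.CutLineWitness

open Literature.MathematicalPhysics.QuantumManyBody.BoseGas

/-- **The pointwise transfer given (E2) at `v`.** For an admissible `v` such that `e^{-TH}1`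
vanishes uniformly near the configurations with a relative position in `hardVec v` (hypothesis
(E2) of line `Sketch`, for this `v` only), the two-replica clause at `v` implies the landscape
clause at `v` (parts (B), (C), (E1a), (E1b), (F) are theorems; glue `glue_landscape_at`).
[folklore] -/
theorem landscapeClause_of_twoReplicaClause {v : ℝ → ℝ≥0∞} (hv : IsRepulsiveFiniteRange v)
    (HE2 : ∀ {N : ℕ} (L : ℝ) {T : ℝ} (_ : 0 < T) {η : ℝ} (_ : 0 < η),
      ∃ κ : ℝ, 0 < κ ∧ ∀ X : Config N,
        (∃ i j : Fin N, i ≠ j ∧ ∃ z ∈ hardVec v, dist (X i - X j) z < κ) →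
          fkSemigroup v L T (fun _ => (1 : ℝ≥0∞)) X ≤ ENNReal.ofReal η)
    (hTR : ∃ ρ₀ : ℝ, 0 < ρ₀ ∧ ∀ ρ : ℝ, 0 < ρ → ρ < ρ₀ → ∃ C : ℝ, 0 < C ∧
      ∀ᶠ n : ℕ in Filter.atTop, ∀ T : ℝ, 1 ≤ T →
        ∫⁻ Y : Config n, ENNReal.ofReal (sideLength ρ (n + 1) ^ 3) *
          (∫⁻ x, (‖fkWitness (N := n + 1) v (sideLength ρ (n + 1)) T (fun _ => (1 : ℝ≥0∞))
            (Matrix.vecCons x Y)‖₊ : ℝ≥0∞) ^ 2) ^ 2 /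
          (∫⁻ x, (‖fkWitness (N := n + 1) v (sideLength ρ (n + 1)) T (fun _ => (1 : ℝ≥0∞))
            (Matrix.vecCons x Y)‖₊ : ℝ≥0∞)) ^ 2 ≤ ENNReal.ofReal C) :
    ∃ ρ₀ : ℝ, 0 < ρ₀ ∧ ∀ ρ : ℝ, 0 < ρ → ρ < ρ₀ → ∃ C : ℝ, 0 < C ∧
      ∀ᶠ n : ℕ in Filter.atTop, ∀ δ : ℝ≥0∞, 0 < δ →
        ∃ Ψ : TrialState (n + 1) (sideLength ρ (n + 1)),
          energy v Ψ ≤ groundStateEnergy v (n + 1) (sideLength ρ (n + 1)) + δ ∧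
          (∀ X, Ψ.ψ X = (‖Ψ.ψ X‖ : ℂ)) ∧
          ∫⁻ Y : Config n, ENNReal.ofReal (sideLength ρ (n + 1) ^ 3) *
            (∫⁻ x, (‖Ψ.ψ (Matrix.vecCons x Y)‖₊ : ℝ≥0∞) ^ 2) ^ 2 /
              (∫⁻ x, (‖Ψ.ψ (Matrix.vecCons x Y)‖₊ : ℝ≥0∞)) ^ 2 ≤ ENNReal.ofReal C := by
  obtain ⟨ρ₁, hρ₁, H1⟩ := hTR
  obtain ⟨ρ₂, hρ₂, H2⟩ := glue_eventually_groundStateEnergy_ne_top v hv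
  refine ⟨min ρ₁ ρ₂, lt_min hρ₁ hρ₂, fun ρ hρ hρlt => ?_⟩
  obtain ⟨C, hC, hevC⟩ := H1 ρ hρ (hρlt.trans_le (min_le_left _ _))
  refine ⟨C + 1, by linarith, ?_⟩
  filter_upwards [hevC, H2 ρ hρ (hρlt.trans_le (min_le_right _ _))] with n hrat hEfin
  intro δ hδ
  exact glue_landscape_at (fun hv L _ hT h0 _ ht => stub_heig hv L hT h0 ht)
    (fun hv _ hL hN hE => stub_envelope hv hL hN hE)
    (fun hv _ hL _ hΨm _ hM hnn h0 hnorm _ heig => stub_formBound hv hL hΨm hM hnn h0 hnorm heig)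
    (fun hv _ hL _ hfm _ hM hnn hsymm hpos _ hSm hSbox _ hr₀ hmargin hSV _ hK hev _ hε =>
      stub_trialState hv hL hfm hM hnn hsymm hpos hSm hSbox hr₀ hmargin hSV hK hev hε)
    (fun hfm _ hM hnn _ hr₀ h0 _ hε => stub_ratio_mollify hfm hM hnn hr₀ h0 hε)
    hv HE2 (sideLength_pos_of_pos hρ (Nat.succ_pos n)) hEfin hC.le hrat hδ

/-! ### Potentials without a hard set -/

/-- If every relative position has a ball on which `v(|·|)` has finite integral, the hard set is
empty. [folklore] -/
theorem hardVec_eq_empty_of_ballIntegral_lt_top {v : ℝ → ℝ≥0∞}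
    (h : ∀ z : Space, ∃ η : ℝ, 0 < η ∧ ballIntegral v z η < ⊤) : hardVec v = ∅ :=
  Set.eq_empty_of_forall_notMem fun z hz => by
    obtain ⟨η, hη, hfin⟩ := h z
    exact absurd (hz η hη) hfin.ne

/-- **A bounded pair potential has no hard set.** [folklore] -/
theorem hardVec_eq_empty_of_bounded {v : ℝ → ℝ≥0∞} {C : ℝ≥0} (hC : ∀ r, v r ≤ C) :
    hardVec v = ∅ := by
  refine hardVec_eq_empty_of_ballIntegral_lt_top fun z => ⟨1, one_pos, ?_⟩
  calc ballIntegral v z 1 ≤ ∫⁻ _w in ball z 1, (C : ℝ≥0∞) := lintegral_mono fun w => hC _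
    _ = C * volume (ball z (1 : ℝ)) := setLIntegral_const _ _
    _ < ⊤ := ENNReal.mul_lt_top ENNReal.coe_lt_top measure_ball_lt_top

/-- **A soft pair potential (`∫ v(|x|) dx < ∞`) has no hard set.** [folklore] -/
theorem hardVec_eq_empty_of_lintegral_ne_top {v : ℝ → ℝ≥0∞} (h : (∫⁻ x : Space, v ‖x‖) ≠ ⊤) :
    hardVec v = ∅ := by
  refine hardVec_eq_empty_of_ballIntegral_lt_top fun z => ⟨1, one_pos, ?_⟩
  exact lt_of_le_of_lt (setLIntegral_le_lintegral _ _) h.lt_top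

/-- **The pointwise transfer for potentials without a hard set.** For an admissible `v` with
`hardVec v = ∅`, the two-replica clause at `v` implies the landscape clause at `v` ((E2) is
vacuous). [folklore] -/
theorem landscapeClause_of_twoReplicaClause_of_hardVec_eq_empty {v : ℝ → ℝ≥0∞}
    (hv : IsRepulsiveFiniteRange v) (hH : hardVec v = ∅)
    (hTR : ∃ ρ₀ : ℝ, 0 < ρ₀ ∧ ∀ ρ : ℝ, 0 < ρ → ρ < ρ₀ → ∃ C : ℝ, 0 < C ∧
      ∀ᶠ n : ℕ in Filter.atTop, ∀ T : ℝ, 1 ≤ T →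
        ∫⁻ Y : Config n, ENNReal.ofReal (sideLength ρ (n + 1) ^ 3) *
          (∫⁻ x, (‖fkWitness (N := n + 1) v (sideLength ρ (n + 1)) T (fun _ => (1 : ℝ≥0∞))
            (Matrix.vecCons x Y)‖₊ : ℝ≥0∞) ^ 2) ^ 2 /
          (∫⁻ x, (‖fkWitness (N := n + 1) v (sideLength ρ (n + 1)) T (fun _ => (1 : ℝ≥0∞))
            (Matrix.vecCons x Y)‖₊ : ℝ≥0∞)) ^ 2 ≤ ENNReal.ofReal C) :
    ∃ ρ₀ : ℝ, 0 < ρ₀ ∧ ∀ ρ : ℝ, 0 < ρ → ρ < ρ₀ → ∃ C : ℝ, 0 < C ∧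
      ∀ᶠ n : ℕ in Filter.atTop, ∀ δ : ℝ≥0∞, 0 < δ →
        ∃ Ψ : TrialState (n + 1) (sideLength ρ (n + 1)),
          energy v Ψ ≤ groundStateEnergy v (n + 1) (sideLength ρ (n + 1)) + δ ∧
          (∀ X, Ψ.ψ X = (‖Ψ.ψ X‖ : ℂ)) ∧
          ∫⁻ Y : Config n, ENNReal.ofReal (sideLength ρ (n + 1) ^ 3) *
            (∫⁻ x, (‖Ψ.ψ (Matrix.vecCons x Y)‖₊ : ℝ≥0∞) ^ 2) ^ 2 /
              (∫⁻ x, (‖Ψ.ψ (Matrix.vecCons x Y)‖₊ : ℝ≥0∞)) ^ 2 ≤ ENNReal.ofReal C :=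
  landscapeClause_of_twoReplicaClause hv (fun {_} _ {_} _ {_} _ => ⟨1, one_pos, fun X hX => by
    obtain ⟨_, _, _, z, hz, _⟩ := hX
    rw [hH] at hz
    exact absurd hz (Set.notMem_empty z)⟩) hTR

open Summit.AtomisticToContinuum.BoseEinsteinCondensation.Theses.BECCutLineWeakDisorder in
/-- **The crux's conclusion for bounded potentials.** Under the engine
`TwoReplicaTransienceBound`, every admissible BOUNDED `v` satisfies the hinge clause of
`LandscapeBound`. [folklore] -/
theorem witnessTransfer_of_bounded (hTR : TwoReplicaTransienceBound) (v : ℝ → ℝ≥0∞)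
    (hv : IsRepulsiveFiniteRange v) {C : ℝ≥0} (hC : ∀ r, v r ≤ C) :
    ∃ ρ₀ : ℝ, 0 < ρ₀ ∧ ∀ ρ : ℝ, 0 < ρ → ρ < ρ₀ → ∃ C : ℝ, 0 < C ∧
      ∀ᶠ n : ℕ in Filter.atTop, ∀ δ : ℝ≥0∞, 0 < δ →
        ∃ Ψ : TrialState (n + 1) (sideLength ρ (n + 1)),
          energy v Ψ ≤ groundStateEnergy v (n + 1) (sideLength ρ (n + 1)) + δ ∧
          (∀ X, Ψ.ψ X = (‖Ψ.ψ X‖ : ℂ)) ∧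
          ∫⁻ Y : Config n, ENNReal.ofReal (sideLength ρ (n + 1) ^ 3) *
            (∫⁻ x, (‖Ψ.ψ (Matrix.vecCons x Y)‖₊ : ℝ≥0∞) ^ 2) ^ 2 /
              (∫⁻ x, (‖Ψ.ψ (Matrix.vecCons x Y)‖₊ : ℝ≥0∞)) ^ 2 ≤ ENNReal.ofReal C :=
  landscapeClause_of_twoReplicaClause_of_hardVec_eq_empty hv (hardVec_eq_empty_of_bounded hC)
    (hTR v hv)

open Summit.AtomisticToContinuum.BoseEinsteinCondensation.Theses.BECCutLineWeakDisorder in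
/-- **The crux's conclusion for soft potentials.** Under the engine `TwoReplicaTransienceBound`,
every admissible `v` with `∫ v(|x|) dx < ∞` satisfies the hinge clause of `LandscapeBound`.
[folklore] -/
theorem witnessTransfer_of_soft (hTR : TwoReplicaTransienceBound) (v : ℝ → ℝ≥0∞)
    (hv : IsRepulsiveFiniteRange v) (hsoft : (∫⁻ x : Space, v ‖x‖) ≠ ⊤) :
    ∃ ρ₀ : ℝ, 0 < ρ₀ ∧ ∀ ρ : ℝ, 0 < ρ → ρ < ρ₀ → ∃ C : ℝ, 0 < C ∧
      ∀ᶠ n : ℕ in Filter.atTop, ∀ δ : ℝ≥0∞, 0 < δ →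
        ∃ Ψ : TrialState (n + 1) (sideLength ρ (n + 1)),
          energy v Ψ ≤ groundStateEnergy v (n + 1) (sideLength ρ (n + 1)) + δ ∧
          (∀ X, Ψ.ψ X = (‖Ψ.ψ X‖ : ℂ)) ∧
          ∫⁻ Y : Config n, ENNReal.ofReal (sideLength ρ (n + 1) ^ 3) *
            (∫⁻ x, (‖Ψ.ψ (Matrix.vecCons x Y)‖₊ : ℝ≥0∞) ^ 2) ^ 2 /
              (∫⁻ x, (‖Ψ.ψ (Matrix.vecCons x Y)‖₊ : ℝ≥0∞)) ^ 2 ≤ ENNReal.ofReal C :=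
  landscapeClause_of_twoReplicaClause_of_hardVec_eq_empty hv
    (hardVec_eq_empty_of_lintegral_ne_top hsoft) (hTR v hv)

/-! ### Appendix: hard spheres, strongly repulsive hard sets, pointwise vanishing -/

open Summit.AtomisticToContinuum.BoseEinsteinCondensation.Theses.BECCutLineWeakDisorder

/-- **The crux's conclusion for the hard-sphere gas.** Under the engine
`TwoReplicaTransienceBound`, every admissible `v` that is `⊤` on `[0, a)` (`a > 0`) and whose hard
set is contained in the closed ball of radius `a` satisfies the hinge clause of `LandscapeBound`.
[cite: LSSY2005, Ch. 2, paragraph after eq. (2.1)] -/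
theorem witnessTransfer_of_hardSphere (hTR : TwoReplicaTransienceBound) (v : ℝ → ℝ≥0∞)
    (hv : IsRepulsiveFiniteRange v) {a : ℝ} (ha : 0 < a)
    (hcore : ∀ r : ℝ, 0 ≤ r → r < a → v r = ⊤)
    (hHa : hardVec v ⊆ Metric.closedBall (0 : Space) a) :
    ∃ ρ₀ : ℝ, 0 < ρ₀ ∧ ∀ ρ : ℝ, 0 < ρ → ρ < ρ₀ → ∃ C : ℝ, 0 < C ∧
      ∀ᶠ n : ℕ in Filter.atTop, ∀ δ : ℝ≥0∞, 0 < δ →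
        ∃ Ψ : TrialState (n + 1) (sideLength ρ (n + 1)),
          energy v Ψ ≤ groundStateEnergy v (n + 1) (sideLength ρ (n + 1)) + δ ∧
          (∀ X, Ψ.ψ X = (‖Ψ.ψ X‖ : ℂ)) ∧
          ∫⁻ Y : Config n, ENNReal.ofReal (sideLength ρ (n + 1) ^ 3) *
            (∫⁻ x, (‖Ψ.ψ (Matrix.vecCons x Y)‖₊ : ℝ≥0∞) ^ 2) ^ 2 /
              (∫⁻ x, (‖Ψ.ψ (Matrix.vecCons x Y)‖₊ : ℝ≥0∞)) ^ 2 ≤ ENNReal.ofReal C :=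
  landscapeClause_of_twoReplicaClause hv
    (fun {_} L {_} hT {_} hη => stub_vanish_hardSphere ha hcore hHa L hT hη) (hTR v hv)

/-- **The crux's conclusion for strongly repulsive hard sets.** Under the engine
`TwoReplicaTransienceBound`, every admissible `v` dominating an inverse power `> 2` of the distance
to each hard point (`v(|w|) ≥ c d^{-p}` whenever `dist(w, z) ≤ d < r₁`, `d > 0`, `z ∈ hardVec v`)
satisfies the hinge clause of `LandscapeBound`. [folklore] -/
theorem witnessTransfer_of_strongRepulsion (hTR : TwoReplicaTransienceBound) (v : ℝ → ℝ≥0∞)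
    (hv : IsRepulsiveFiniteRange v) {p c r₁ : ℝ} (hp : 2 < p) (hc : 0 < c) (hr₁ : 0 < r₁)
    (hrep : ∀ z ∈ hardVec v, ∀ w : Space, ∀ d : ℝ, 0 < d → d < r₁ → dist w z ≤ d →
      ENNReal.ofReal (c * d ^ (-p)) ≤ v ‖w‖) :
    ∃ ρ₀ : ℝ, 0 < ρ₀ ∧ ∀ ρ : ℝ, 0 < ρ → ρ < ρ₀ → ∃ C : ℝ, 0 < C ∧
      ∀ᶠ n : ℕ in Filter.atTop, ∀ δ : ℝ≥0∞, 0 < δ →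
        ∃ Ψ : TrialState (n + 1) (sideLength ρ (n + 1)),
          energy v Ψ ≤ groundStateEnergy v (n + 1) (sideLength ρ (n + 1)) + δ ∧
          (∀ X, Ψ.ψ X = (‖Ψ.ψ X‖ : ℂ)) ∧
          ∫⁻ Y : Config n, ENNReal.ofReal (sideLength ρ (n + 1) ^ 3) *
            (∫⁻ x, (‖Ψ.ψ (Matrix.vecCons x Y)‖₊ : ℝ≥0∞) ^ 2) ^ 2 /
              (∫⁻ x, (‖Ψ.ψ (Matrix.vecCons x Y)‖₊ : ℝ≥0∞)) ^ 2 ≤ ENNReal.ofReal C :=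
  landscapeClause_of_twoReplicaClause hv
    (fun {_} L {_} hT {_} hη => stub_vanish_of_strongRepulsion hp hc hr₁ hrep L hT hη) (hTR v hv)

/-- **The crux's conclusion given pointwise vanishing at the hard-set configurations.** Under the
engine `TwoReplicaTransienceBound`, every admissible `v` for which `(e^{-TH_N}1)(X) = 0` whenever
some `xᵢ − xⱼ` (`i ≠ j`) lies in `hardVec v` (for all `N`, `L`, `T > 0`) satisfies the hinge
clause of `LandscapeBound` — the general case of the crux reduces to this almost-sure
infinite-action statement. [folklore] -/
theorem witnessTransfer_of_pointwiseVanishing (hTR : TwoReplicaTransienceBound) (v : ℝ → ℝ≥0∞)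
    (hv : IsRepulsiveFiniteRange v)
    (hZ : ∀ (N : ℕ) (L : ℝ) (T : ℝ), 0 < T → ∀ X : Config N,
      (∃ i j : Fin N, i ≠ j ∧ X i - X j ∈ hardVec v) →
        fkSemigroup v L T (fun _ => (1 : ℝ≥0∞)) X = 0) :
    ∃ ρ₀ : ℝ, 0 < ρ₀ ∧ ∀ ρ : ℝ, 0 < ρ → ρ < ρ₀ → ∃ C : ℝ, 0 < C ∧
      ∀ᶠ n : ℕ in Filter.atTop, ∀ δ : ℝ≥0∞, 0 < δ →
        ∃ Ψ : TrialState (n + 1) (sideLength ρ (n + 1)),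
          energy v Ψ ≤ groundStateEnergy v (n + 1) (sideLength ρ (n + 1)) + δ ∧
          (∀ X, Ψ.ψ X = (‖Ψ.ψ X‖ : ℂ)) ∧
          ∫⁻ Y : Config n, ENNReal.ofReal (sideLength ρ (n + 1) ^ 3) *
            (∫⁻ x, (‖Ψ.ψ (Matrix.vecCons x Y)‖₊ : ℝ≥0∞) ^ 2) ^ 2 /
              (∫⁻ x, (‖Ψ.ψ (Matrix.vecCons x Y)‖₊ : ℝ≥0∞)) ^ 2 ≤ ENNReal.ofReal C :=
  landscapeClause_of_twoReplicaClause hv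
    (fun {N} L {T} hT {_} hη => stub_vanish_of_pointwise hv.1 L hT (hZ N L T hT) hη) (hTR v hv)


/-! ### The textbook class: hard core plus a bounded tail -/

/-- If the potential is bounded beyond radius `a`, its hard set lies in the closed ball of radius
`a`. [folklore] -/
theorem hardVec_subset_closedBall_of_bounded_tail {v : ℝ → ℝ≥0∞} {a : ℝ} {C : ℝ≥0}
    (htail : ∀ r : ℝ, a < r → v r ≤ C) : hardVec v ⊆ Metric.closedBall (0 : Space) a := by
  intro z hz
  by_contra hza
  rw [Metric.mem_closedBall, dist_zero_right, not_le] at hza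
  set ε : ℝ := (‖z‖ - a) / 2 with hε
  have hε0 : 0 < ε := by rw [hε]; linarith
  have hfin : ballIntegral v z ε < ⊤ := by
    have hle : ∀ w ∈ ball z ε, v ‖w‖ ≤ C := fun w hw => by
      refine htail _ ?_
      have h1 : ‖z‖ - ‖w‖ ≤ ‖z - w‖ := norm_sub_norm_le z w
      have h2 : ‖z - w‖ < ε := by rwa [← dist_eq_norm, dist_comm]
      rw [hε] at h2; linarith
    calc ballIntegral v z ε ≤ ∫⁻ _w in ball z ε, (C : ℝ≥0∞) :=
          setLIntegral_mono measurable_const hle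
      _ = C * volume (ball z ε) := setLIntegral_const _ _
      _ < ⊤ := ENNReal.mul_lt_top ENNReal.coe_lt_top measure_ball_lt_top
  exact absurd (hz ε hε0) hfin.ne

/-- **The crux's conclusion for the textbook hard-core class.** Under the engine
`TwoReplicaTransienceBound`, every admissible `v` with `v = ⊤` on `[0, a)` (`a > 0`) and `v`
bounded beyond `a` (the value at `r = a` is free) satisfies the hinge clause of `LandscapeBound`:
the hard-sphere gas with any bounded finite-range tail.
[cite: LSSY2005, Ch. 2, paragraph after eq. (2.1)] -/
theorem witnessTransfer_of_hardCore_boundedTail (hTR : TwoReplicaTransienceBound) (v : ℝ → ℝ≥0∞)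
    (hv : IsRepulsiveFiniteRange v) {a : ℝ} (ha : 0 < a)
    (hcore : ∀ r : ℝ, 0 ≤ r → r < a → v r = ⊤) {C : ℝ≥0} (htail : ∀ r : ℝ, a < r → v r ≤ C) :
    ∃ ρ₀ : ℝ, 0 < ρ₀ ∧ ∀ ρ : ℝ, 0 < ρ → ρ < ρ₀ → ∃ C : ℝ, 0 < C ∧
      ∀ᶠ n : ℕ in Filter.atTop, ∀ δ : ℝ≥0∞, 0 < δ →
        ∃ Ψ : TrialState (n + 1) (sideLength ρ (n + 1)),
          energy v Ψ ≤ groundStateEnergy v (n + 1) (sideLength ρ (n + 1)) + δ ∧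
          (∀ X, Ψ.ψ X = (‖Ψ.ψ X‖ : ℂ)) ∧
          ∫⁻ Y : Config n, ENNReal.ofReal (sideLength ρ (n + 1) ^ 3) *
            (∫⁻ x, (‖Ψ.ψ (Matrix.vecCons x Y)‖₊ : ℝ≥0∞) ^ 2) ^ 2 /
              (∫⁻ x, (‖Ψ.ψ (Matrix.vecCons x Y)‖₊ : ℝ≥0∞)) ^ 2 ≤ ENNReal.ofReal C :=
  witnessTransfer_of_hardSphere hTR v hv ha hcore (hardVec_subset_closedBall_of_bounded_tail htail)

end Summit.AtomisticToContinuum.BoseEinsteinCondensation.Theorems.CutLineWitness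

end
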